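import Literature.NumberTheory.EllipticCurves.ModularSymbolRepProofs

/-!
# `ManinStokes` (stmt-KontsevichZagierPeriods-5277): the tile integrand `ω/dj` — generic facts

Support file (prover-owned, `--supports stmt-KontsevichZagierPeriods-5277`). Facts about the quotient
`djQuot φ = ω/dj = −φΔ/(E₄²E₆)` of `ModularSymbolRep` that do not involve the tile: Ramanujan's identity in
product form `j' · (ω/dj) = 2πi φ` off the elliptic orbits and the bound `‖j'‖‖ω/dj‖ ≤ 2π‖φ‖` everywhere;
continuity of `ω/dj` off the elliptic orbits and complex differentiability of `(ω/dj) ∘ ofComplex` there;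
transport of integrability between `ℝ¹ = (Fin 1 → ℝ)` and `ℝ`.

References: D. Zagier, *Elliptic modular forms and their applications* (2008), §5.1 (53);
M. Kontsevich, D. Zagier, *Periods* (2001), §3.4. No definitions, no named facts.
-/

noncomputable section

open scoped MatrixGroups ModularForm Modular Manifold Topology
open CongruenceSubgroup Complex Set Filter MeasureTheory ModularForm
open UpperHalfPlane hiding I
open Literature.NumberTheory.EllipticCurves Literature.NumberTheory.EllipticCurves.ModularForms

namespace Summit.KontsevichZagierPeriods.HeckeMultiplicityOne.ManinStokes

/-- **`j'(τ) · djQuot φ τ = 2πi φ(τ)`** off the elliptic orbits (`E₄(τ) E₆(τ) ≠ 0`): the defining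
property of `djQuot φ = 2πi φ/j'` (Ramanujan's `j' = −2πi E₄²E₆/Δ`, `deriv_kleinJ_comp_ofComplex`). [folklore] -/
theorem deriv_kleinJ_mul_djQuot {τ : ℍ} (h4 : E₄ τ ≠ 0) (h6 : E₆ τ ≠ 0) (φ : ℍ → ℂ) :
    deriv (kleinJ ∘ ofComplex) τ * djQuot φ τ = 2 * Real.pi * I * φ τ := by
  rw [deriv_kleinJ_comp_ofComplex, djQuot]
  have hΔ := ModularForm.discriminant_ne_zero τ
  field_simp

/-- **`‖j'(τ)‖ · ‖djQuot φ τ‖ ≤ 2π ‖φ(τ)‖`** for every `τ` (equality off the elliptic orbits, `0 ≤ …` on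
them, where both `j'` and the junk value of `djQuot` vanish). [folklore] -/
theorem norm_deriv_kleinJ_mul_djQuot_le (τ : ℍ) (φ : ℍ → ℂ) :
    ‖deriv (kleinJ ∘ ofComplex) τ‖ * ‖djQuot φ τ‖ ≤ 2 * Real.pi * ‖φ τ‖ := by
  by_cases h : E₄ τ ≠ 0 ∧ E₆ τ ≠ 0
  · rw [← norm_mul, deriv_kleinJ_mul_djQuot h.1 h.2]
    simp [abs_of_pos Real.pi_pos]
  · have h0 : deriv (kleinJ ∘ ofComplex) τ = 0 := by
      by_contra hne
      exact h ((deriv_kleinJ_ne_zero_iff τ).mp hne)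
    rw [h0, norm_zero, zero_mul]
    positivity

/-- Transport of integrability over a coordinate set of `ℝ¹` to `ℝ`. [folklore] -/
theorem integrableOn_fin1_iff {E : Type*} [NormedAddCommGroup E] (G : ℝ → E) {s : Set ℝ} :
    IntegrableOn (fun x : Fin 1 → ℝ => G (x 0)) {x | x 0 ∈ s} ↔ IntegrableOn G s := by
  have hmp := volume_preserving_funUnique (Fin 1) ℝ
  have h := hmp.integrableOn_comp_preimage
    (MeasurableEquiv.funUnique (Fin 1) ℝ).measurableEmbedding (f := G) (s := s)
  have hpre : (MeasurableEquiv.funUnique (Fin 1) ℝ) ⁻¹' s = {x : Fin 1 → ℝ | x 0 ∈ s} := by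
    ext x
    simp [MeasurableEquiv.funUnique, Fin.default_eq_zero]
  rw [hpre] at h
  exact Iff.trans Iff.rfl h

/-- `ω/dj` is continuous on `ℍ` off the elliptic orbits. [folklore] -/
theorem continuousOn_djQuot {φ : ℍ → ℂ} (hφ : MDifferentiable 𝓘(ℂ) 𝓘(ℂ) φ) :
    ContinuousOn (djQuot φ) {z : ℍ | E₄ z ≠ 0 ∧ E₆ z ≠ 0} := by
  have hc : Continuous φ := hφ.continuous
  have h4 : Continuous (E₄ : ℍ → ℂ) := (E₄ : ModularForm 𝒮ℒ 4).holo'.continuous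
  have h6 : Continuous (E₆ : ℍ → ℂ) := (E₆ : ModularForm 𝒮ℒ 6).holo'.continuous
  have hΔ : Continuous (ModularForm.discriminant : ℍ → ℂ) := CuspForm.discriminant.holo'.continuous
  have heq : djQuot φ = fun z => -(φ z * ModularForm.discriminant z) / (E₄ z ^ 2 * E₆ z) := rfl
  rw [heq]
  refine ((hc.mul hΔ).neg).continuousOn.div ((h4.pow 2).mul h6).continuousOn fun z hz => ?_
  exact mul_ne_zero (pow_ne_zero _ hz.1) hz.2

/-- `ω/dj ∘ ofComplex` is complex differentiable at points of `ℍ` off the elliptic orbits. [folklore] -/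
theorem differentiableAt_djQuot_comp_ofComplex {φ : ℍ → ℂ} (hφ : MDifferentiable 𝓘(ℂ) 𝓘(ℂ) φ)
    {z : ℍ} (h4 : E₄ z ≠ 0) (h6 : E₆ z ≠ 0) :
    DifferentiableAt ℂ (djQuot φ ∘ ofComplex) (z : ℂ) := by
  have hmem : (z : ℂ) ∈ {w : ℂ | 0 < w.im} := z.im_pos
  have hnhds := UpperHalfPlane.isOpen_upperHalfPlaneSet.mem_nhds hmem
  have hφd : DifferentiableAt ℂ (φ ∘ ofComplex) z :=
    (UpperHalfPlane.mdifferentiable_iff.mp hφ).differentiableAt hnhds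
  have h4d : DifferentiableAt ℂ (E₄ ∘ ofComplex) z :=
    (UpperHalfPlane.mdifferentiable_iff.mp (E₄ : ModularForm 𝒮ℒ 4).holo').differentiableAt hnhds
  have h6d : DifferentiableAt ℂ (E₆ ∘ ofComplex) z :=
    (UpperHalfPlane.mdifferentiable_iff.mp (E₆ : ModularForm 𝒮ℒ 6).holo').differentiableAt hnhds
  have hΔd : DifferentiableAt ℂ (ModularForm.discriminant ∘ ofComplex) z :=
    (UpperHalfPlane.mdifferentiable_iff.mp CuspForm.discriminant.holo').differentiableAt hnhds
  have heq : djQuot φ ∘ ofComplex = fun w => -((φ ∘ ofComplex) w * (ModularForm.discriminant ∘ ofComplex) w) /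
      ((E₄ ∘ ofComplex) w ^ 2 * (E₆ ∘ ofComplex) w) := by
    funext w; simp [djQuot]
  rw [heq]
  refine ((hφd.mul hΔd).neg).div ((h4d.pow 2).mul h6d) ?_
  simp only [Function.comp_apply, UpperHalfPlane.ofComplex_apply]
  exact mul_ne_zero (pow_ne_zero _ h4) h6

end Summit.KontsevichZagierPeriods.HeckeMultiplicityOne.ManinStokes
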